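import Summits.BirchSwinnertonDyer.BirchSwinnertonDyer.Theorems.ManinLocalTwoThreeThirdTranslateCuspNine
import Summits.BirchSwinnertonDyer.BirchSwinnertonDyer.Theorems.ManinLocalTwoThreeAdditiveDyadicTransport
import Summits.BirchSwinnertonDyer.Rank1Residual.Additive.LegendreTwistRelationOfCharTwist
import Summits.BirchSwinnertonDyer.BirchSwinnertonDyer.Theorems.ManinLocalTwoThreeDyadicDepthSieve
import Literature.NumberTheory.DiophantineApproximation.SparseDyadicRationals
import HarnessLib

set_option linter.dupNamespace false
set_option autoImplicit false

/-!
# THE TRIADIC TWIST TRANSPORT OF CUSP IMAGES (es g53, MEMO-es §82; cell bsd-f2-manin, LENS es; TURNKEY T-es-121)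

Landed by LEAD p1 g26 from `HOME/es/g53/Sketch-es-g53.lean` 491a955cdc2b7e18 (`--supports stmt-BirchSwinnertonDyer-22968`, helper;
route `ManinLocalTwoThree`, crux C3 `ManinPrimeToThreeAtNine` / C2 `ManinOddAtFour`): namespace moved under `Theorems`, the route
file is NOT imported (the half-translate lemma comes through `…AdditiveDyadicTransport`), §1 is now the tree's
`ManinLocalTwoThreeDyadicDepthSieve.modularSymbol_sub_mem_periodLattice_of_matrixData` (T-es-120), and the `Prop` packaging
(`TriadicDepthSieve`, `TriadicDepthSieveOnCurve`, `IsOptimal`, `EightSumShape`) is INLINED into the theorem statements (pure proof file).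

The `p = 3` twin of the dyadic depth sieve (es g52, MEMO-es §81) together with the ORDER-LEVEL transfer formula the
dyadic memo left open (§81 NEXT (iii)).  Everything here is a THEOREM (no `sorry`, standard axioms); §6 uses the tree's
dyadic pairing to give the dyadic order-transfer twin.

* §1  Explicit cusp transport on `Γ₀(N)`: the tree's matrix lemma (T-es-120, `…DyadicDepthSieve`).
* §2  **E-es-303 (THIRD-SHIFT CUSP CLASS).**  `¬ 3^(2j+4) ∣ N`, `3^(j+2) ∣ den x` ⟹ `{∞, x + i/3}_f − {∞, x}_f ∈ Λ_f`
      for every integer `i` (the cusp `x` is fixed by `t_{1/3}` on `X₀(N)` iff `2·v₃(den x) ≥ v₃(N) + 1`; `j = 0`: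
      `81 ∤ N`, `9 ∣ den`; `j = 1`: `729 ∤ N`, `27 ∣ den`).  Generalises the tree's `a/9`-class lemma
      (`modularSymbol_div_nine_sub_mem_periodLattice`, only `q = 9` at `9 ∥ N`) to every level and every 3-depth.
* §2  **E-es-304 (t-FIXED CUSPS ARE 3-TORSION).**  With `9 ∣ N` and `3`-depleted `f` (every newform):
      `3·{∞, x}_f ∈ Λ_f` at every such cusp — the INTERMEDIATE depths at `27 ∣ N` (`v₃(N) = 3, v₃(den) = 2`;
      `v₃(N) ∈ {4,5}, v₃(den) = 3, 4 < v₃ N`) are new relative to an's T(i) (cusps ABOVE `∞`, `3^{v₃N} ∣ den`) and to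
      the tree's `cuspImage_one_div_nine_three_torsion` (`9 ∥ N`).
* §3  Birch's lemma read on cusps for `χ₋₃`: `g(χ)·{∞, x}_{f⊗χ} = {∞, x+⅓}_f − {∞, x+⅔}_f` (the cell's twisting
      operator `R_χ = t_{1/3} − t_{2/3}` of desc §55.14 evaluated on cusps) ⟹ **E-es-305 (TRIADIC SIEVE)**
      `g(χ)·{∞, x}_{f⊗χ} ∈ Λ_f` at every `t_{1/3}`-fixed cusp — no depletion and no `9 ∣ N` needed.
* §4  **E-es-306 / 306′ (SIEVE ON A TWIST PAIR OF CURVES)** through the cell's lattice relation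
      `z ∈ Λ_W ↔ g(χ)·r⁻¹·z ∈ Λ_A` (shape of `neronLattice_mem_iff_of_twist_of_sq_eq`, `s = g(χ₋₃)`, `s² = −3`,
      `r¹²Δ(W) = (−3)⁶Δ(A)`, `r ∈ {1, 3}`): `r·c·{∞,x}_{f_W} ∈ Λ_W` at every `t_{1/3}`-fixed cusp (`c = c(D′)` given
      `c(D) ∣ c(D′)`, resp. `c = c(D)` with no hypothesis) ⟹ on the NON-MINIMAL member (`r = 1`) every `t`-fixed cusp,
      in particular every cusp above `∞` at `3`, maps to `O`; **E-es-307** exponent transport `exp C(W) ∣ r·exp C(A)`.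
* §5  **E-es-308 (ORDER TRANSFER, exact iff):** `t·c′·{∞,x}_{f_W} ∈ Λ_W ↔ (t/r)·c′·({∞,x+⅓}_{f_A} − {∞,x+⅔}_{f_A}) ∈ Λ_A`
      for every `t : ℂ` — the order of `φ_W(x)` is READ OFF the partner's symbols; §6 **E-es-308d** the dyadic twin
      with `{∞,x+⅛} + ε{∞,x+⅜}`.
* §5  **E-es-309 (CERTIFICATE SILENCE):** on an optimal non-minimal member with `c(D′) ∣ c(D)` (desc 71.A
      `maninConstant_dvd_mul_of_oddTwist_defect`, `r = 1`) a `t`-fixed cusp image is killed by `c(D)/c(D′)`: an's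
      CDT-free cusp certificate at `3` can fire on `W` only if `3 ∣ c(A)/c(W)`.

Census (BC5 witness, MEMO-es §82.6, pack HOME/es/g53/): exact same-level `χ₋₃`-pairs of optimal curves `9 ∣ N ≤ 540`.
PARTITION 0 · C2/C3 OPEN ⟸ CDT · BSD is not proved by this file.
-/

open scoped MatrixGroups ModularForm
open CongruenceSubgroup

namespace Summit.BirchSwinnertonDyer.BirchSwinnertonDyer.Theorems.ManinLocalTwoThreeTriadicDepthSieve

open Literature.NumberTheory.EllipticCurves Literature.NumberTheory.EllipticCurves.ModularForms
open Summit.BirchSwinnertonDyer.BirchSwinnertonDyer.Theorems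
open Summit.BirchSwinnertonDyer.BirchSwinnertonDyer.Theorems.ManinLocalTwoThree
open Summit.BirchSwinnertonDyer.Rank1Residual.Additive Summit.BirchSwinnertonDyer.Rank1Residual.ManinAdditive
open Summit.BirchSwinnertonDyer.BirchSwinnertonDyer.Theorems.ManinLocalTwoThreeDyadicDepthSieve

/-! ### §2  E-es-303 / E-es-304: the third-shift cusp class and the `t_{1/3}`-fixed 3-torsion law -/

/-- `3 ∣ z² − 1` for `z` prime to `3`. -/
theorem three_dvd_sq_sub_one_of_not_three_dvd {z : ℤ} (hz : ¬ 3 ∣ z) : ∃ t : ℤ, z ^ 2 - 1 = 3 * t := by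
  obtain ⟨y, hy | hy⟩ : ∃ y : ℤ, z = 3 * y + 1 ∨ z = 3 * y + 2 := ⟨z / 3, by omega⟩
  · exact ⟨3 * y ^ 2 + 2 * y, by rw [hy]; ring⟩
  · exact ⟨3 * y ^ 2 + 4 * y + 1, by rw [hy]; ring⟩

/-- From `N ≠ 0`, `¬ 3^(B+1) ∣ N`: `N = 3^k·m` with `3 ∤ m` and `3^k ∣ 3^B`. -/
theorem exists_three_pow_mul_of_not_dvd {N : ℕ} (hN : N ≠ 0) (B : ℕ) (hB : ¬ 3 ^ (B + 1) ∣ N) :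
    ∃ (k : ℕ) (m : ℕ), ¬ 3 ∣ m ∧ N = 3 ^ k * m ∧ (3 : ℤ) ^ k ∣ 3 ^ B := by
  obtain ⟨k, m, hm, hNkm⟩ := Nat.exists_eq_pow_mul_and_not_dvd hN 3 (by norm_num)
  have hk : k ≤ B := by
    by_contra hk
    rw [not_le] at hk
    exact hB (hNkm ▸ Dvd.dvd.mul_right (pow_dvd_pow 3 hk) m)
  exact ⟨k, m, hm, hNkm, pow_dvd_pow 3 hk⟩

/-- **Core of E-es-303** (explicit integers).  `q = 3q₃`, Bezout `a p + b q = 1`, an auxiliary `Z` with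
`(p + i q₃)²·Z ≡ 1 (mod 3)` and `N ∣ 3q₃²Z`.  Witness for §1: `p' = p + i q₃`, `v = a`, `u = −b`, `w = a − q₃·i·a·p'·Z`,
`s = −b − i·a·t`; then `q(v − w) = 3q₃²·i a p'·Z`.  Conclusion `{∞, p/q + i/3}_f − {∞, p/q}_f ∈ Λ_f`. -/
theorem modularSymbol_add_third_sub_mem_periodLattice_core {N : ℕ} [NeZero N] (f : CuspForm (Gamma0 N) 2)
    (p q₃ a b i Z t : ℤ) (hq : q₃ ≠ 0) (hab : a * p + b * (3 * q₃) = 1)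
    (hZ : (p + i * q₃) ^ 2 * Z - 1 = 3 * t) (hNZ : (N : ℤ) ∣ 3 * q₃ ^ 2 * Z) :
    modularSymbol f ((p : ℚ) / ((3 * q₃ : ℤ) : ℚ) + (i : ℚ) / 3) - modularSymbol f ((p : ℚ) / ((3 * q₃ : ℤ) : ℚ))
      ∈ periodLattice f := by
  obtain ⟨e, he⟩ := hNZ
  have h3q : (3 * q₃ : ℤ) ≠ 0 := mul_ne_zero (by norm_num) hq
  have key := modularSymbol_sub_mem_periodLattice_of_matrixData f p (3 * q₃) (p + i * q₃) (-b) a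
    (-b - i * a * t) (a - q₃ * i * a * (p + i * q₃) * Z) h3q (by linear_combination hab)
    (by linear_combination hab - q₃ * i * a * hZ)
    ⟨e * (i * a * (p + i * q₃)), by linear_combination (i * a * (p + i * q₃)) * he⟩
  have hq' : ((3 * q₃ : ℤ) : ℚ) ≠ 0 := by exact_mod_cast h3q
  rwa [show (((p + i * q₃ : ℤ)) : ℚ) / ((3 * q₃ : ℤ) : ℚ) = (p : ℚ) / ((3 * q₃ : ℤ) : ℚ) + (i : ℚ) / 3 by
      field_simp; push_cast; ring] at key

/-- **E-es-303 `ThirdShiftCuspClass` (THEOREM).**  On `X₀(N)` with `¬ 3^(2j+4) ∣ N`, a cusp `x` with `3^(j+2) ∣ den x` is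
`Γ₀(N)`-equivalent to all its third-translates: `{∞, x + i/3}_f − {∞, x}_f ∈ Λ_f` for every `i : ℤ`
(`j = 0`: `81 ∤ N`, `9 ∣ den x`; `j = 1`: `729 ∤ N`, `27 ∣ den x`; in general the `t_{1/3}`-fixed criterion
`2·v₃(den x) ≥ v₃(N) + 1`).  Proof: the core lemma with `Z = m²`, `N = 3^k m`, `3 ∤ m`, `k ≤ 2j + 3`. -/
theorem modularSymbol_add_third_sub_mem_periodLattice {N : ℕ} [NeZero N] (f : CuspForm (Gamma0 N) 2)
    (j : ℕ) (hN : ¬ 3 ^ (2 * j + 4) ∣ N) (x : ℚ) (hx : (3 : ℤ) ^ (j + 2) ∣ (x.den : ℤ)) (i : ℤ) :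
    modularSymbol f (x + (i : ℚ) / 3) - modularSymbol f x ∈ periodLattice f := by
  obtain ⟨q', hq'⟩ := hx
  obtain ⟨k, m, hm, hNkm, e, he⟩ := exists_three_pow_mul_of_not_dvd (NeZero.ne N) (2 * j + 3) hN
  obtain ⟨a, b, hab⟩ := Literature.NumberTheory.DiophantineApproximation.isCoprime_num_den x
  set p : ℤ := x.num with hp
  set q₃ : ℤ := 3 ^ (j + 1) * q' with hq₃
  have hq3 : (x.den : ℤ) = 3 * q₃ := by rw [hq', hq₃]; ring
  have hq0 : q₃ ≠ 0 := by
    intro h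
    have : (x.den : ℤ) = 0 := by rw [hq3, h, mul_zero]
    exact absurd (by exact_mod_cast this) x.den_nz
  rw [hq3] at hab
  have hp3 : ¬ 3 ∣ p := by
    rintro ⟨c, hc⟩
    have : (3 : ℤ) ∣ 1 := ⟨a * c + b * q₃, by rw [← hab, hc]; ring⟩
    omega
  have hp'3 : ¬ 3 ∣ p + i * q₃ := by
    rintro ⟨c, hc⟩
    exact hp3 ⟨c - i * 3 ^ j * q', by rw [hq₃] at hc; linear_combination hc⟩
  have hm3 : ¬ (3 : ℤ) ∣ (m : ℤ) := by exact_mod_cast hm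
  have hpm : ¬ 3 ∣ (p + i * q₃) * (m : ℤ) := fun h ↦
    ((Int.prime_three.dvd_mul).mp h).elim hp'3 hm3
  obtain ⟨t, ht⟩ := three_dvd_sq_sub_one_of_not_three_dvd hpm
  have key := modularSymbol_add_third_sub_mem_periodLattice_core f p q₃ a b i ((m : ℤ) ^ 2) t hq0 hab
    (by linear_combination ht)
    ⟨e * q' ^ 2 * (m : ℤ), by rw [hNkm, hq₃]; push_cast; linear_combination (q' ^ 2 * (m : ℤ) ^ 2) * he⟩
  have hxq : ((3 * q₃ : ℤ) : ℚ) = (x.den : ℚ) := by rw [← hq3, Int.cast_natCast]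
  rwa [hxq, hp, Rat.num_div_den] at key

/-- **E-es-304 `TFixedCuspThreeTorsion` (THEOREM).**  `9 ∣ N`, `f` with vanishing coefficients `a_n`, `3 ∣ n` (every
newform at `9 ∣ N`), `¬ 3^(2j+4) ∣ N`, `3^(j+2) ∣ den x` ⟹ `3·{∞, x}_f ∈ Λ_f`: the image of every `t_{1/3}`-fixed cusp is
`3`-torsion.  Proof: `3{x} = ({x} + {x+⅓} + {x+⅔}) − ({x+⅓} − {x}) − ({x+⅔} − {x})`, THIRD-TRANSLATE + E-es-303. -/
theorem three_mul_modularSymbol_mem_periodLattice_of_thirdFixed {N : ℕ} [NeZero N] (f : CuspForm (Gamma0 N) 2)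
    (h9 : 3 ^ 2 ∣ N) (hdep : ∀ n : ℕ, 3 ∣ n → cuspCoeff f n = 0)
    (j : ℕ) (hN : ¬ 3 ^ (2 * j + 4) ∣ N) (x : ℚ) (hx : (3 : ℤ) ^ (j + 2) ∣ (x.den : ℤ)) :
    3 * modularSymbol f x ∈ periodLattice f := by
  obtain ⟨χ, hχ, hprim⟩ := exists_isQuadratic_isPrimitive_three
  have h0 := modularSymbol_third_translate_sum_eq_zero h9 hχ hprim f hdep x
  have h1 := modularSymbol_add_third_sub_mem_periodLattice f j hN x hx 1
  have h2 := modularSymbol_add_third_sub_mem_periodLattice f j hN x hx 2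
  rw [show ((1 : ℤ) : ℚ) / 3 = 1 / 3 by norm_num] at h1
  rw [show ((2 : ℤ) : ℚ) / 3 = 2 / 3 by norm_num] at h2
  rw [show 3 * modularSymbol f x = (modularSymbol f x + modularSymbol f (x + 1 / 3) + modularSymbol f (x + 2 / 3))
      - (modularSymbol f (x + 1 / 3) - modularSymbol f x) - (modularSymbol f (x + 2 / 3) - modularSymbol f x) by ring,
    h0]
  exact sub_mem (sub_mem (zero_mem _) h1) h2

/-- **E-es-304 for newforms at `9 ∣ N`** (a newform at `3² ∣ N` is `3`-depleted). -/
theorem three_mul_modularSymbol_mem_periodLattice_of_thirdFixed_of_isNewform0 {N : ℕ} [NeZero N]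
    {f : CuspForm (Gamma0 N) 2} (hf : IsNewform0 f) (h9 : 3 ^ 2 ∣ N)
    (j : ℕ) (hN : ¬ 3 ^ (2 * j + 4) ∣ N) (x : ℚ) (hx : (3 : ℤ) ^ (j + 2) ∣ (x.den : ℤ)) :
    3 * modularSymbol f x ∈ periodLattice f := by
  refine three_mul_modularSymbol_mem_periodLattice_of_thirdFixed f h9 (fun n hn => ?_) j hN x hx
  obtain ⟨n', rfl⟩ := hn
  have h3N : 3 ∣ N := (dvd_pow_self 3 two_ne_zero).trans h9
  rw [hf.cuspCoeff_prime_mul Nat.prime_three n', if_pos h3N, sub_zero,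
    hf.cuspCoeff_eq_zero_of_sq_dvd Nat.prime_three h9, zero_mul]

/-- **E-es-304 on a curve**: for any `X₀(N)`-datum `D` of `W` (`9 ∣ N`, `¬3^(2j+4) ∣ N`) the image `φ_D(x)` of a cusp with
`3^(j+2) ∣ den x` satisfies `3·(c·{∞,x}_f) ∈ Λ_W`, i.e. `φ_D(x) ∈ W[3]`. -/
theorem cuspImage_three_torsion_of_thirdFixed {W : WeierstrassCurve ℚ} [W.IsElliptic] {N : ℕ} [NeZero N]
    (D : ModularParametrizationData W N) (hnew : IsNewform0 D.f) (h9 : 3 ^ 2 ∣ N)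
    (j : ℕ) (hN : ¬ 3 ^ (2 * j + 4) ∣ N) (x : ℚ) (hx : (3 : ℤ) ^ (j + 2) ∣ (x.den : ℤ)) :
    3 * ((D.c : ℂ) * modularSymbol D.f x) ∈ D.L.lattice := by
  have h := D.smul_periodLattice_le _
    (three_mul_modularSymbol_mem_periodLattice_of_thirdFixed_of_isNewform0 hnew h9 j hN x hx)
  rw [show (D.c : ℂ) * (3 * modularSymbol D.f x) = 3 * ((D.c : ℂ) * modularSymbol D.f x) by ring] at h
  exact h

/-! ### §3  Birch's lemma on cusps for `χ₋₃` and the TRIADIC SIEVE (E-es-305) -/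

/-- `g(χ₋₃)·{∞, x}_{f⊗χ} = {∞, x+⅓}_f − {∞, x+⅔}_f` (tree: `modularSymbol_charTwist` + `sum_chi_three_mul`): the
twisting operator `R_χ = t_{1/3} − t_{2/3}` on cusps. No hypothesis on `f` or `N`. -/
theorem gaussSum_mul_modularSymbol_charTwist_three {N : ℕ} [NeZero N] (f : CuspForm (Gamma0 N) 2)
    (L : ℕ) [NeZero L] (hN : N ∣ L) (hm : 3 ^ 2 ∣ L) {χ : DirichletCharacter ℂ 3} (hχ : χ.IsQuadratic)
    (hprim : χ.IsPrimitive) (x : ℚ) :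
    gaussSum χ (ZMod.stdAddChar (N := 3)) * modularSymbol (charTwist L hN hm hχ f) x =
      modularSymbol f (x + 1 / 3) - modularSymbol f (x + 2 / 3) := by
  have hG : gaussSum χ (ZMod.stdAddChar (N := 3)) ≠ 0 := gaussSum_stdAddChar_ne_zero_of_isPrimitive hprim
  rw [ModularForms.modularSymbol_charTwist L hN hm hχ f x, ← mul_assoc, mul_inv_cancel₀ hG, one_mul,
    sum_chi_three_mul hχ hprim, twistShift_one_three, twistShift_two_three]

/-- **E-es-305 `TriadicDepthSieve` (THEOREM; the Prop of MEMO-es §82 inlined as the statement).**  For ANY `f ∈ S₂(Γ₀(N))` with `¬3^(2j+4) ∣ N`,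
`χ` the primitive quadratic character mod `3`, and every cusp `x` with `3^(j+2) ∣ den x`:
`g(χ)·{∞, x}_{f⊗χ} ∈ Λ_f` — the twisted symbol is a period at every `t_{1/3}`-fixed cusp, since
`{x+⅓} − {x+⅔} = ({x+⅓} − {x}) − ({x+⅔} − {x})`. -/
theorem triadicDepthSieve_holds :
  ∀ (N : ℕ) [NeZero N] (f : CuspForm (Gamma0 N) 2) (j : ℕ), ¬ 3 ^ (2 * j + 4) ∣ N →
    ∀ (L : ℕ) [NeZero L] (hN : N ∣ L) (hm : 3 ^ 2 ∣ L) (χ : DirichletCharacter ℂ 3) (hχ : χ.IsQuadratic),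
      χ.IsPrimitive →
    ∀ x : ℚ, (3 : ℤ) ^ (j + 2) ∣ (x.den : ℤ) →
      gaussSum χ (ZMod.stdAddChar (N := 3)) * modularSymbol (charTwist L hN hm hχ f) x ∈ periodLattice f := by
  intro N _ f j hN L _ hNL hm χ hχ hprim x hx
  have h1 := modularSymbol_add_third_sub_mem_periodLattice f j hN x hx 1
  have h2 := modularSymbol_add_third_sub_mem_periodLattice f j hN x hx 2
  rw [show ((1 : ℤ) : ℚ) / 3 = 1 / 3 by norm_num] at h1
  rw [show ((2 : ℤ) : ℚ) / 3 = 2 / 3 by norm_num] at h2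
  rw [gaussSum_mul_modularSymbol_charTwist_three f L hNL hm hχ hprim x,
    show modularSymbol f (x + 1 / 3) - modularSymbol f (x + 2 / 3) =
      (modularSymbol f (x + 1 / 3) - modularSymbol f x) - (modularSymbol f (x + 2 / 3) - modularSymbol f x) by ring]
  exact sub_mem h1 h2

/-! ### §4  E-es-306 / 306′ / 307: the sieve on a `χ₋₃`-twist pair of curves and exponent transport -/

/-- Reading `f_W = f_A ⊗ χ₋₃` at level `9N`. -/
theorem modularSymbol_eq_charTwist_nine_mul {A : WeierstrassCurve ℚ} {N : ℕ} [NeZero N] [NeZero (9 * N)]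
    (D : ModularParametrizationData A N) {W : WeierstrassCurve ℚ} {L : ℕ} [NeZero L]
    (D' : ModularParametrizationData W L) {χ : DirichletCharacter ℂ 3} (hχ : χ.IsQuadratic) (hprim : χ.IsPrimitive)
    (hf : ∀ n : ℕ, cuspCoeff D'.f n = χ n * cuspCoeff D.f n) (x : ℚ) :
    modularSymbol D'.f x =
      modularSymbol (charTwist (9 * N) (dvd_mul_left N 9) (⟨N, by norm_num⟩ : 3 ^ 2 ∣ 9 * N) hχ D.f) x :=
  modularSymbol_eq_of_forall_cuspCoeff_eq D'.f _
    (fun n ↦ by rw [hf n, cuspCoeff_charTwist (9 * N) (dvd_mul_left N 9) _ hχ hprim D.f n]) _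

/-- `g(χ)·{∞,x}_{f_W} = {∞,x+⅓}_{f_A} − {∞,x+⅔}_{f_A}` on a `χ₋₃`-twist pair of data. -/
theorem gaussSum_mul_modularSymbol_twistPair {A : WeierstrassCurve ℚ} {N : ℕ} [NeZero N]
    (D : ModularParametrizationData A N) {W : WeierstrassCurve ℚ} {L : ℕ} [NeZero L]
    (D' : ModularParametrizationData W L) {χ : DirichletCharacter ℂ 3} (hχ : χ.IsQuadratic) (hprim : χ.IsPrimitive)
    (hf : ∀ n : ℕ, cuspCoeff D'.f n = χ n * cuspCoeff D.f n) (x : ℚ) :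
    gaussSum χ (ZMod.stdAddChar (N := 3)) * modularSymbol D'.f x =
      modularSymbol D.f (x + 1 / 3) - modularSymbol D.f (x + 2 / 3) := by
  haveI : NeZero (9 * N) := ⟨mul_ne_zero (by norm_num) (NeZero.ne N)⟩
  rw [modularSymbol_eq_charTwist_nine_mul D D' hχ hprim hf x,
    gaussSum_mul_modularSymbol_charTwist_three D.f (9 * N) _ _ hχ hprim x]

/-- **E-es-306 `TriadicDepthSieveOnCurve`** (THEOREM; the Prop of MEMO-es §82 inlined as the statement).  `A` with an `X₀(N)`-datum `D`
(`¬3^(2j+4) ∣ N`), `W` with an `X₀(L)`-datum `D′` whose newform is the `χ₋₃`-twist of `f_A`, Néron lattices related by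
`z ∈ Λ_W ↔ g(χ)·r⁻¹·z ∈ Λ_A` (`r ≠ 0`; `r = 1` ⟺ `W` is the non-minimal member, `Δ_min(W) = 3⁶Δ_min(A)`; `r = 3` ⟺ `W`
minimal) and `c(D) ∣ c(D′)`.  Then `r·c(D′)·{∞, x}_{f_W} ∈ Λ_W` at every cusp with `3^(j+2) ∣ den x`: on the
non-minimal member every `t_{1/3}`-fixed cusp — in particular every cusp above `∞` at `3` — maps to `O ∈ W`. -/
theorem triadicDepthSieveOnCurve_holds :
  ∀ (A : WeierstrassCurve ℚ) [A.IsElliptic] (N : ℕ) [NeZero N] (D : ModularParametrizationData A N)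
    (W : WeierstrassCurve ℚ) [W.IsElliptic] (L : ℕ) [NeZero L] (D' : ModularParametrizationData W L)
    (j : ℕ), ¬ 3 ^ (2 * j + 4) ∣ N →
    ∀ (χ : DirichletCharacter ℂ 3), χ.IsQuadratic → χ.IsPrimitive →
    (∀ n : ℕ, cuspCoeff D'.f n = χ n * cuspCoeff D.f n) →
    ∀ (r : ℚ), r ≠ 0 →
    (∀ z : ℂ, z ∈ D'.L.lattice ↔ gaussSum χ (ZMod.stdAddChar (N := 3)) * (((r : ℚ) : ℂ)⁻¹ * z) ∈ D.L.lattice) →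
    D.c ∣ D'.c →
    ∀ x : ℚ, (3 : ℤ) ^ (j + 2) ∣ (x.den : ℤ) →
      ((r : ℚ) : ℂ) * ((D'.c : ℂ) * modularSymbol D'.f x) ∈ D'.L.lattice := by
  intro A _ N _ D W _ L _ D' j hN χ hχ hprim hf r hr hLC hcc x hx
  haveI : NeZero (9 * N) := ⟨mul_ne_zero (by norm_num) (NeZero.ne N)⟩
  have hr' : ((r : ℚ) : ℂ) ≠ 0 := by exact_mod_cast hr
  obtain ⟨q, hq⟩ := hcc
  have hw := triadicDepthSieve_holds N D.f j hN (9 * N) (dvd_mul_left N 9) ⟨N, by norm_num⟩ χ hχ hprim x hx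
  rw [← modularSymbol_eq_charTwist_nine_mul D D' hχ hprim hf x] at hw
  rw [hLC, ← mul_assoc (((r : ℚ) : ℂ)⁻¹), inv_mul_cancel₀ hr', one_mul, hq,
    show gaussSum χ (ZMod.stdAddChar (N := 3)) * (((D.c * q : ℤ) : ℂ) * modularSymbol D'.f x) =
      (q : ℂ) * ((D.c : ℂ) * (gaussSum χ (ZMod.stdAddChar (N := 3)) * modularSymbol D'.f x)) by push_cast; ring,
    ← zsmul_eq_mul]
  exact zsmul_mem (D.smul_periodLattice_le _ hw) q

/-- **E-es-306′ (THEOREM, `c`-hypothesis-free form).**  Same data WITHOUT `c(D) ∣ c(D′)`: `r·c(D)·{∞, x}_{f_W} ∈ Λ_W` at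
every cusp with `3^(j+2) ∣ den x` — the point `φ_{D′}(x)` is killed by `r·c(D)/c(D′)` whenever that is an integer
(desc 71.A gives `c(D′) ∣ r′·c(D)` for optimal `D′`, `W` additive at `3`). -/
theorem triadicDepthSieveOnCurve_cfree
    (A : WeierstrassCurve ℚ) [A.IsElliptic] (N : ℕ) [NeZero N] (D : ModularParametrizationData A N)
    (W : WeierstrassCurve ℚ) [W.IsElliptic] (L : ℕ) [NeZero L] (D' : ModularParametrizationData W L)
    (j : ℕ) (hN : ¬ 3 ^ (2 * j + 4) ∣ N)
    (χ : DirichletCharacter ℂ 3) (hχ : χ.IsQuadratic) (hprim : χ.IsPrimitive)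
    (hf : ∀ n : ℕ, cuspCoeff D'.f n = χ n * cuspCoeff D.f n) {r : ℚ} (hr : r ≠ 0)
    (hLC : ∀ z : ℂ, z ∈ D'.L.lattice ↔
      gaussSum χ (ZMod.stdAddChar (N := 3)) * (((r : ℚ) : ℂ)⁻¹ * z) ∈ D.L.lattice)
    (x : ℚ) (hx : (3 : ℤ) ^ (j + 2) ∣ (x.den : ℤ)) :
    ((r : ℚ) : ℂ) * ((D.c : ℂ) * modularSymbol D'.f x) ∈ D'.L.lattice := by
  haveI : NeZero (9 * N) := ⟨mul_ne_zero (by norm_num) (NeZero.ne N)⟩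
  have hr' : ((r : ℚ) : ℂ) ≠ 0 := by exact_mod_cast hr
  have hw := triadicDepthSieve_holds N D.f j hN (9 * N) (dvd_mul_left N 9) ⟨N, by norm_num⟩ χ hχ hprim x hx
  rw [← modularSymbol_eq_charTwist_nine_mul D D' hχ hprim hf x] at hw
  rw [hLC, ← mul_assoc (((r : ℚ) : ℂ)⁻¹), inv_mul_cancel₀ hr', one_mul,
    show gaussSum χ (ZMod.stdAddChar (N := 3)) * ((D.c : ℂ) * modularSymbol D'.f x) =
      (D.c : ℂ) * (gaussSum χ (ZMod.stdAddChar (N := 3)) * modularSymbol D'.f x) by ring]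
  exact D.smul_periodLattice_le _ hw

/-- **E-es-307 (THEOREM) — exponent transport along a `χ₋₃`-twist with defect `r`.**  If an integer `m` kills every cusp
image of `A` (`m·c(D)·{∞,y}_{f_A} ∈ Λ_A` for all `y`), then `r·m` kills every cusp image of `W` (given `c(D) ∣ c(D′)`):
`exp C(W) ∣ r·exp C(A)`; for an exact pair both directions apply (`r = 1` one way, `r = 3` the other), so the
prime-to-`3` parts of `exp C(A)`, `exp C(W)` coincide and the `3`-parts differ by at most one factor `3`. -/
theorem torsionExponent_transport_of_triadicTwist_defect
    (A : WeierstrassCurve ℚ) [A.IsElliptic] (N : ℕ) [NeZero N] (D : ModularParametrizationData A N)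
    (W : WeierstrassCurve ℚ) [W.IsElliptic] (L : ℕ) [NeZero L] (D' : ModularParametrizationData W L)
    (χ : DirichletCharacter ℂ 3) (hχ : χ.IsQuadratic) (hprim : χ.IsPrimitive)
    (hf : ∀ n : ℕ, cuspCoeff D'.f n = χ n * cuspCoeff D.f n) {r : ℚ} (hr : r ≠ 0)
    (hLC : ∀ z : ℂ, z ∈ D'.L.lattice ↔
      gaussSum χ (ZMod.stdAddChar (N := 3)) * (((r : ℚ) : ℂ)⁻¹ * z) ∈ D.L.lattice)
    (hcc : D.c ∣ D'.c) (m : ℤ) (hkill : ∀ y : ℚ, (m : ℂ) * ((D.c : ℂ) * modularSymbol D.f y) ∈ D.L.lattice)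
    (x : ℚ) : ((r : ℚ) : ℂ) * ((m : ℂ) * ((D'.c : ℂ) * modularSymbol D'.f x)) ∈ D'.L.lattice := by
  have hr' : ((r : ℚ) : ℂ) ≠ 0 := by exact_mod_cast hr
  have hpair := gaussSum_mul_modularSymbol_twistPair D D' hχ hprim hf x
  obtain ⟨q, hq⟩ := hcc
  rw [hLC, ← mul_assoc (((r : ℚ) : ℂ)⁻¹), inv_mul_cancel₀ hr', one_mul, hq,
    show gaussSum χ (ZMod.stdAddChar (N := 3)) * ((m : ℂ) * (((D.c * q : ℤ) : ℂ) * modularSymbol D'.f x)) =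
      (q : ℂ) * (m : ℂ) * (D.c : ℂ) * (gaussSum χ (ZMod.stdAddChar (N := 3)) * modularSymbol D'.f x) by
        push_cast; ring, hpair]
  have h1 := zsmul_mem (hkill (x + 1 / 3)) q
  have h2 := zsmul_mem (hkill (x + 2 / 3)) q
  rw [zsmul_eq_mul] at h1 h2
  rw [show (q : ℂ) * (m : ℂ) * (D.c : ℂ) * (modularSymbol D.f (x + 1 / 3) - modularSymbol D.f (x + 2 / 3))
      = (q : ℂ) * ((m : ℂ) * ((D.c : ℂ) * modularSymbol D.f (x + 1 / 3)))
        - (q : ℂ) * ((m : ℂ) * ((D.c : ℂ) * modularSymbol D.f (x + 2 / 3))) by ring]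
  exact sub_mem h1 h2

/-! ### §5  E-es-308: the ORDER-TRANSFER law (exact iff) and E-es-309: certificate silence -/

/-- **E-es-308 `TriadicOrderTransfer` (THEOREM).**  On a `χ₋₃`-twist pair of data with lattice relation
`z ∈ Λ_W ↔ g(χ)·r⁻¹·z ∈ Λ_A`, for every `t : ℂ` and every rational `x`:
`t·c(D′)·{∞,x}_{f_W} ∈ Λ_W ↔ r⁻¹·t·c(D′)·({∞,x+⅓}_{f_A} − {∞,x+⅔}_{f_A}) ∈ Λ_A`.
With `Λ_A = c(D)·Λ_{f_A}` (optimal) and `c(D) = c(D′)`: the ORDER of `φ_W(x)` in `W(ℂ)` is the order of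
`r⁻¹·({∞,x+⅓} − {∞,x+⅔})_{f_A}` in `ℂ/Λ_{f_A}` — read off the partner (census §82.6: predicted = observed at every cusp). -/
theorem cuspOrder_transfer_iff
    (A : WeierstrassCurve ℚ) [A.IsElliptic] (N : ℕ) [NeZero N] (D : ModularParametrizationData A N)
    (W : WeierstrassCurve ℚ) [W.IsElliptic] (L : ℕ) [NeZero L] (D' : ModularParametrizationData W L)
    (χ : DirichletCharacter ℂ 3) (hχ : χ.IsQuadratic) (hprim : χ.IsPrimitive)
    (hf : ∀ n : ℕ, cuspCoeff D'.f n = χ n * cuspCoeff D.f n) (r : ℚ)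
    (hLC : ∀ z : ℂ, z ∈ D'.L.lattice ↔
      gaussSum χ (ZMod.stdAddChar (N := 3)) * (((r : ℚ) : ℂ)⁻¹ * z) ∈ D.L.lattice)
    (t : ℂ) (x : ℚ) :
    t * ((D'.c : ℂ) * modularSymbol D'.f x) ∈ D'.L.lattice ↔
      ((r : ℚ) : ℂ)⁻¹ * t * (D'.c : ℂ) * (modularSymbol D.f (x + 1 / 3) - modularSymbol D.f (x + 2 / 3))
        ∈ D.L.lattice := by
  have hpair := gaussSum_mul_modularSymbol_twistPair D D' hχ hprim hf x
  rw [hLC, show gaussSum χ (ZMod.stdAddChar (N := 3)) * ((((r : ℚ) : ℂ))⁻¹ * (t * ((D'.c : ℂ) * modularSymbol D'.f x)))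
      = ((r : ℚ) : ℂ)⁻¹ * t * (D'.c : ℂ) * (gaussSum χ (ZMod.stdAddChar (N := 3)) * modularSymbol D'.f x) by ring,
    hpair]

/-- **E-es-309 `CertificateSilenceOnNonMinimalMember` (THEOREM).**  Exact ALIGNED pair (`r = 1`: `W` the non-minimal
member), `D′` optimal with `c(D′) ≠ 0` and `c(D′) ∣ c(D)` (desc 71.A `maninConstant_dvd_mul_of_oddTwist_defect` with
`r = 1`), `¬3^(2j+4) ∣ N`.  Then at every cusp `x` with `3^(j+2) ∣ den x` the image `φ_{D′}(x)` is killed by the INTEGER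
`c(D)/c(D′)`: `(c(D)/c(D′))·{∞,x}_{f_W} ∈ Λ_{f_W}`.  Hence if `3 ∤ c(D)/c(D′)` these images (orders `∣ 3` by E-es-304)
all VANISH: an's CDT-free cusp certificate at `3` (a cusp above `∞` at `3` with `{∞,x}_{f_W} ∉ Λ_{f_W}` ⟹ `3 ∤ c(D′)`)
is SILENT on `W` unless `3 ∣ c(A)/c(W)`, i.e. unless it simultaneously exhibits `3 ∣ c(A)`. -/
theorem cuspImage_killed_by_maninRatio_of_alignedTwist
    (A : WeierstrassCurve ℚ) [A.IsElliptic] (N : ℕ) [NeZero N] (D : ModularParametrizationData A N)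
    (W : WeierstrassCurve ℚ) [W.IsElliptic] (L : ℕ) [NeZero L] (D' : ModularParametrizationData W L)
    (j : ℕ) (hN : ¬ 3 ^ (2 * j + 4) ∣ N)
    (χ : DirichletCharacter ℂ 3) (hχ : χ.IsQuadratic) (hprim : χ.IsPrimitive)
    (hf : ∀ n : ℕ, cuspCoeff D'.f n = χ n * cuspCoeff D.f n)
    (hLC : ∀ z : ℂ, z ∈ D'.L.lattice ↔ gaussSum χ (ZMod.stdAddChar (N := 3)) * ((((1 : ℚ) : ℚ) : ℂ)⁻¹ * z) ∈ D.L.lattice)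
    (hopt : ∀ z ∈ D'.L.lattice, ∃ w ∈ periodLattice D'.f, z = D'.c * w) (hc0 : D'.c ≠ 0) (k : ℤ)
    (hk : D.c = D'.c * k)
    (x : ℚ) (hx : (3 : ℤ) ^ (j + 2) ∣ (x.den : ℤ)) :
    (k : ℂ) * modularSymbol D'.f x ∈ periodLattice D'.f := by
  have h := triadicDepthSieveOnCurve_cfree A N D W L D' j hN χ hχ hprim hf one_ne_zero hLC x hx
  obtain ⟨w, hw, hEq⟩ := hopt _ h
  have hc0' : (D'.c : ℂ) ≠ 0 := by exact_mod_cast hc0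
  have : (k : ℂ) * modularSymbol D'.f x = w := by
    apply mul_left_cancel₀ hc0'
    rw [← hEq, hk]
    push_cast
    ring
  rw [this]
  exact hw

/-! ### §6  E-es-308d: the DYADIC order-transfer twin (g52 NEXT (iii); pairing = the tree's
`ManinLocalTwoThreeDyadicDepthSieve.gaussSum_mul_modularSymbol_charTwist_eq_two_mul`, sum shape `F1 + εF3 − F5 − εF7`) -/

/-- **E-es-308d `DyadicOrderTransfer` (THEOREM).**  On a `χ±8`-twist pair of data (`4 ∣ N`, even coefficients of `f_A`
vanish, `f_W = f_A ⊗ χ` with `Σ_u χ(u)F(u) = F1 + εF3 − F5 − εF7`, lattice relation `z ∈ Λ_W ↔ (g(χ)/2)·r⁻¹·z ∈ Λ_A`), for all `t : ℂ`, `x`: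
`t·c(D′)·{∞,x}_{f_W} ∈ Λ_W ↔ r⁻¹·t·c(D′)·({∞,x+⅛}_{f_A} + ε{∞,x+⅜}_{f_A}) ∈ Λ_A` — the exact order of `φ_W(x)` from the
partner's symbols (answers MEMO-es §81 NEXT (iii); census §82.6 (d)). -/
theorem cuspOrder_transfer_iff_dyadic
    (A : WeierstrassCurve ℚ) [A.IsElliptic] (N : ℕ) [NeZero N] (D : ModularParametrizationData A N)
    (W : WeierstrassCurve ℚ) [W.IsElliptic] (L : ℕ) [NeZero L] (D' : ModularParametrizationData W L)
    (h4 : 4 ∣ N) (heven : ∀ n : ℕ, 2 ∣ n → cuspCoeff D.f n = 0)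
    (χ : DirichletCharacter ℂ 8) (hχ : χ.IsQuadratic) (hprim : χ.IsPrimitive) (ε : ℤ)
    (hsum : ∀ F : ZMod 8 → ℂ, ∑ u : ZMod 8, χ u * F u = F 1 + (ε : ℂ) * F 3 - F 5 - (ε : ℂ) * F 7)
    (hf : ∀ n : ℕ, cuspCoeff D'.f n = χ n * cuspCoeff D.f n) (r : ℚ)
    (hLC : ∀ z : ℂ, z ∈ D'.L.lattice ↔
      gaussSum χ (ZMod.stdAddChar (N := 8)) / 2 * (((r : ℚ) : ℂ)⁻¹ * z) ∈ D.L.lattice)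
    (t : ℂ) (x : ℚ) :
    t * ((D'.c : ℂ) * modularSymbol D'.f x) ∈ D'.L.lattice ↔
      ((r : ℚ) : ℂ)⁻¹ * t * (D'.c : ℂ) * (modularSymbol D.f (x + 1 / 8) + ε * modularSymbol D.f (x + 3 / 8))
        ∈ D.L.lattice := by
  haveI : NeZero (64 * N) := ⟨mul_ne_zero (by norm_num) (NeZero.ne N)⟩
  have hN : N ∣ 64 * N := dvd_mul_left N 64
  have hm : 8 ^ 2 ∣ 64 * N := ⟨N, by norm_num⟩
  have hsym : modularSymbol D'.f x = modularSymbol (charTwist (64 * N) hN hm hχ D.f) x :=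
    modularSymbol_eq_of_forall_cuspCoeff_eq D'.f (charTwist (64 * N) hN hm hχ D.f)
      (fun n ↦ by rw [hf n, cuspCoeff_charTwist (64 * N) hN hm hχ hprim D.f n]) _
  have hpair := gaussSum_mul_modularSymbol_charTwist_eq_two_mul D.f h4 heven (64 * N) hN hm hχ hprim hsum x
  rw [hLC, hsym, show gaussSum χ (ZMod.stdAddChar (N := 8)) / 2 *
      ((((r : ℚ) : ℂ))⁻¹ * (t * ((D'.c : ℂ) * modularSymbol (charTwist (64 * N) hN hm hχ D.f) x)))
      = ((r : ℚ) : ℂ)⁻¹ * t * (D'.c : ℂ) *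
        (gaussSum χ (ZMod.stdAddChar (N := 8)) * modularSymbol (charTwist (64 * N) hN hm hχ D.f) x) / 2 by ring,
    hpair, show ((r : ℚ) : ℂ)⁻¹ * t * (D'.c : ℂ) *
      (2 * (modularSymbol D.f (x + 1 / 8) + (ε : ℂ) * modularSymbol D.f (x + 3 / 8))) / 2
      = ((r : ℚ) : ℂ)⁻¹ * t * (D'.c : ℂ) * (modularSymbol D.f (x + 1 / 8) + (ε : ℂ) * modularSymbol D.f (x + 3 / 8))
      by ring]

end Summit.BirchSwinnertonDyer.BirchSwinnertonDyer.Theorems.ManinLocalTwoThreeTriadicDepthSieve
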